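import Literature.Probability.RandomPlanarGeometry.SAWRenewalBound
import Literature.Probability.RandomPlanarGeometry.SAWLowerBound2604
import Literature.Probability.RandomPlanarGeometry.SAWBridgeSpanGF
import Literature.Probability.RandomPlanarGeometry.SAWTiltedFiniteMemory16T2x1
import Mathlib.Analysis.SpecialFunctions.Pow.Real
import HarnessLib

/-!
# A certified two-sided enclosure of the pulled self-avoiding-walk free energy on `ℤ²` at force `y = 2`

Topic `Literature/Probability/RandomPlanarGeometry` (continues `SAWRenewalBound.lean` — Kesten's renewal lower
bound in the word model —, `SAWLowerBound2604.lean` — the span-1 family —, and the tilted memory-16 certificate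
`SAWTiltedFiniteMemory16T2x1.lean`).

Sources. N. R. Beaton, *The critical pulling force for self-avoiding walks*, J. Phys. A 48 (2015) 16FT03
(arXiv:1407.1917): the pulled-bridge generating function `B(x,y) = Σ_β x^{|β|} y^{h(β)}` (§2, p. 3–4), the
renewal structure `B = I/(1−I)` (Lemma 1, (7)), and Theorem 1 (`y_c = 1`, i.e. the free energy `λ(y) > log μ`
exactly for `y > 1`) — strictness only, no values of `λ(y)`. D. Ioffe, Y. Velenik (2008) prove the ballistic
phase qualitatively; E. J. Janse van Rensburg, S. G. Whittington (2022, arXiv:2203.05470 p. 4) quote Monte-Carlo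
values. NO certified VALUE of a pulled SAW free energy is printed.

## What is new in this file (not in print)

* `Zd.pulledBridgeZ d N y = Σ_A #{N-step bridges of span A} · y^A` (Beaton's `Z^B_N(y)`), `Zd.driftZ d N θ =
  Σ_{ω ∈ SAW_N} e^{θ x₁(ω_N)}` (the drifted partition function over ALL walks), `pulledBridgeZ_le_driftZ`;
* the word-model tilted renewal engine (`Renewal.tseqZ`, `sum_tseqZ_le`, `exists_mul_pow_le_tseqZ`,
  `tseqZ_le_pulledBridgeZ`): if an admissible family `S` of irreducible bridge words containing `[+e₀]` has
  tilted Kraft sum `Σ_{s∈S} x^{|s|} y^{span s} ≥ 1` (`x, y > 0`), then `Z^B_N(y) ≥ κ x^{-N}` for all `N`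
  (Beaton's Lemma 2 made finite and certified, cf. `Renewal.le_connectiveConstant_of_kraft` at `y = 1`);
* **the `y = 2` enclosure (span-1 edition)**: `pulledBridgeZ_two_lower` — `∃ κ > 0, ∀ N,
  κ·(1250/351)^N ≤ Z^B_N(2)` (`1250/351 = 3.5612…`, from the span-1 family `[+e₀] ++ k·[±e₁]`, `k ≤ 60`,
  tilted Kraft sum `2·Σ = 1.0001… ≥ 1` by `norm_num`) — and `driftZ_two_upper` — `∀ N,
  Z_N(log 2) ≤ 2⁴¹ · (7206013/2000000)^N` (`= 3.6030065`, the tilted certificate `checkW_16_2_1`); with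
  `pulledBridgeZ_le_driftZ`: **`e^{λ_B(2)} ∈ [3.5612, 3.6030065]`** for the bridge free energy and
  `e^{λ(2)} ≤ 3.6030065` for the full one (whenever the limits exist; the statements are the finite-`N` bounds).
Axioms: standard, plus the declared `native_decide` certificate `FiniteMemory.checkW_16_2_1` on the UPPER side only.
(Lane «pcv-sawmu» item X26 «PULL-ENCL», K1 edition; objects typed by a-idea-1, proofs a-p5.)
-/

noncomputable section

open Finset Literature.Probability.LatticeModels
open scoped BigOperators

namespace Literature.Probability.RandomPlanarGeometry.SAW

/-! ### The objects -/

namespace Zd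

/-- **Beaton's pulled-bridge partition function** at length `N`: `Z^B_N(y) = Σ_{A=0}^{N} β_{N,A} · y^A`,
`β_{N,A} = #{N-step bridges of span A}` (`Zd.brSpan`). [cite: Beaton2015, §2 (B(x,y))] -/
def pulledBridgeZ (d : ℕ) [NeZero d] (N : ℕ) (y : ℝ) : ℝ :=
  ∑ A ∈ Finset.range (N + 1), ((brSpan d N (A : ℤ)).card : ℝ) * y ^ A

/-- **The drifted partition function over all `N`-step self-avoiding walks**, drift `θ e₁`:
`Z_N(θ) = Σ_{ω ∈ SAW_N} exp(θ · x₁(ω_N))`. [cite: Beaton2015, §1 (C_N(y), pulled walks)] -/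
def driftZ (d : ℕ) [NeZero d] (N : ℕ) (θ : ℝ) : ℝ :=
  ∑ ω ∈ saws d N, Real.exp (θ * ((ω N 0 : ℤ) : ℝ))

/-- The span of a bridge is non-negative. [cite: MadrasSlade1993, Definition 1.2.4] -/
theorem span_nonneg_of_mem_bridges' {d : ℕ} [NeZero d] {N : ℕ} {ω : ℕ → Site d}
    (hω : ω ∈ bridges d N) : 0 ≤ ω N 0 := by
  obtain ⟨hωs, hbr⟩ := mem_bridges.1 hω
  obtain ⟨h00, -, -, -⟩ := mem_saws.1 hωs
  rcases Nat.eq_zero_or_pos N with rfl | hN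
  · rw [h00]; exact le_rfl
  · have h := (hbr N hN le_rfl).1
    rw [h00] at h
    exact le_of_lt h

/-- The span of an `N`-step bridge is at most `N`. [cite: MadrasSlade1993, Definition 1.2.4] -/
theorem span_le_of_mem_bridges' {d : ℕ} [NeZero d] {N : ℕ} {ω : ℕ → Site d}
    (hω : ω ∈ bridges d N) : ω N 0 ≤ N := by
  obtain ⟨hωs, -⟩ := mem_bridges.1 hω
  obtain ⟨h00, -, hadj, -⟩ := mem_saws.1 hωs
  exact (le_abs_self _).trans (abs_apply_le_of_adj h00 hadj N le_rfl 0)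

/-- Walk-sum form: `Z^B_N(y) = Σ_{ω ∈ B_N} y^{span ω}` (fibrewise over the span).
[cite: Beaton2015, §2 (B(x,y))] -/
theorem pulledBridgeZ_eq_sum_bridges (d : ℕ) [NeZero d] (N : ℕ) (y : ℝ) :
    pulledBridgeZ d N y = ∑ ω ∈ bridges d N, y ^ (ω N 0).toNat := by
  classical
  have hmaps : ∀ ω ∈ bridges d N, (ω N 0).toNat ∈ Finset.range (N + 1) := by
    intro ω hω
    have hup := span_le_of_mem_bridges' hω
    rw [Finset.mem_range]
    omega
  rw [pulledBridgeZ, ← Finset.sum_fiberwise_of_maps_to hmaps]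
  refine Finset.sum_congr rfl fun A _ => ?_
  have hfil : (bridges d N).filter (fun ω => (ω N 0).toNat = A) = brSpan d N (A : ℤ) := by
    ext ω
    simp only [Finset.mem_filter, mem_brSpan]
    constructor
    · rintro ⟨hω, h⟩
      have h0 := span_nonneg_of_mem_bridges' hω
      exact ⟨hω, by omega⟩
    · rintro ⟨hω, h⟩
      exact ⟨hω, by omega⟩
  symm
  calc ∑ ω ∈ (bridges d N).filter (fun ω => (ω N 0).toNat = A), y ^ (ω N 0).toNat
      = ∑ ω ∈ (bridges d N).filter (fun ω => (ω N 0).toNat = A), y ^ A := by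
        refine Finset.sum_congr rfl fun ω hω => ?_
        rw [(Finset.mem_filter.1 hω).2]
    _ = ((brSpan d N (A : ℤ)).card : ℝ) * y ^ A := by
        rw [Finset.sum_const, nsmul_eq_mul, hfil]

/-- **`λ_B ≤ λ_full`, finite form**: `Z^B_N(y) ≤ Z_N(log y)` for `y > 0` (bridges are self-avoiding walks and
`y^{span} = e^{(log y)·x₁(ω_N)}`). [cite: Beaton2015, §1–§2] -/
theorem pulledBridgeZ_le_driftZ (d : ℕ) [NeZero d] (N : ℕ) {y : ℝ} (hy : 0 < y) :
    pulledBridgeZ d N y ≤ driftZ d N (Real.log y) := by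
  classical
  rw [pulledBridgeZ_eq_sum_bridges, driftZ]
  have hsub : bridges d N ⊆ saws d N := fun ω hω => (mem_bridges.1 hω).1
  calc ∑ ω ∈ bridges d N, y ^ (ω N 0).toNat
      = ∑ ω ∈ bridges d N, Real.exp (Real.log y * ((ω N 0 : ℤ) : ℝ)) := by
        refine Finset.sum_congr rfl fun ω hω => ?_
        have h0 := span_nonneg_of_mem_bridges' hω
        rw [← Real.rpow_natCast, Real.rpow_def_of_pos hy]
        congr 1
        have : (((ω N 0).toNat : ℕ) : ℝ) = ((ω N 0 : ℤ) : ℝ) := by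
          have h1 : (((ω N 0).toNat : ℕ) : ℤ) = ω N 0 := Int.toNat_of_nonneg h0
          exact_mod_cast h1
        rw [this]
    _ ≤ ∑ ω ∈ saws d N, Real.exp (Real.log y * ((ω N 0 : ℤ) : ℝ)) :=
        Finset.sum_le_sum_of_subset_of_nonneg hsub fun _ _ _ => (Real.exp_pos _).le

end Zd

/-! ### The word-model tilted renewal engine -/

namespace Renewal

variable {S : Finset (List Step)}

variable (S) in
/-- The tilted count of concatenations from `S` of total length `n`: `Σ_{w ∈ seqWords S n} y^{span w}`.
[cite: Beaton2015, Lemma 1 (B = I/(1−I))] -/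
def tseqZ (y : ℝ) (n : ℕ) : ℝ := ∑ w ∈ seqWords S n, y ^ (xEnd w).toNat

/-- `tseqZ ≥ 0` termwise for `y ≥ 0`. [folklore] -/
private theorem tseqZ_nonneg {y : ℝ} (hy : 0 ≤ y) (n : ℕ) : 0 ≤ tseqZ S y n :=
  Finset.sum_nonneg fun _ _ => pow_nonneg hy _

/-- If `[+e₀] ∈ S` then `tseqZ S y n ≥ y^n > 0` for `y > 0` (the straight walk has span `n`).
[cite: Beaton2015, §2] -/
theorem tseqZ_pos (hE : [(0 : Step)] ∈ S) {y : ℝ} (hy : 0 < y) (n : ℕ) : 0 < tseqZ S y n := by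
  have hmem : List.replicate n (0 : Step) ∈ seqWords S n := by
    refine mem_seqWords.2 ⟨by simp, ?_⟩
    refine ⟨List.replicate n [(0 : Step)], fun s hs => ?_, ?_⟩
    · rw [List.eq_of_mem_replicate hs]; exact hE
    · induction n with
      | zero => rfl
      | succ n ih => simp [List.replicate_succ, ih]
  have h1 : y ^ (xEnd (List.replicate n (0 : Step))).toNat ≤ tseqZ S y n :=
    Finset.single_le_sum (f := fun w => y ^ (xEnd w).toNat) (fun _ _ => pow_nonneg hy.le _) hmem
  exact lt_of_lt_of_le (pow_pos hy _) h1

/-- **`tseqZ ≤ Z^B`**: distinct words give distinct bridges with the same span.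
[cite: Beaton2015, §2 (B(x,y))] -/
theorem tseqZ_le_pulledBridgeZ (hS : Admissible S) {y : ℝ} (hy : 0 ≤ y) (n : ℕ) :
    tseqZ S y n ≤ Zd.pulledBridgeZ 2 n y := by
  classical
  rw [tseqZ, Zd.pulledBridgeZ_eq_sum_bridges]
  have himg : (seqWords S n).image traj ⊆ Zd.bridges 2 n := by
    intro ω hω
    obtain ⟨w, hw, rfl⟩ := mem_image.1 hω
    obtain ⟨hl, hseq⟩ := mem_seqWords.1 hw
    obtain ⟨hb, hsaw⟩ := hseq.bridge_saw hS
    exact traj_mem_bridges hl hsaw hb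
  have hinj : Set.InjOn traj (seqWords S n : Set (List Step)) := by
    intro w hw w' hw' h
    exact traj_injOn n (by simp [(mem_seqWords.1 hw).1]) (by simp [(mem_seqWords.1 hw').1]) h
  calc ∑ w ∈ seqWords S n, y ^ (xEnd w).toNat
      = ∑ ω ∈ (seqWords S n).image traj, y ^ (ω n 0).toNat := by
        rw [Finset.sum_image hinj]
        refine Finset.sum_congr rfl fun w hw => ?_
        rw [show xEnd w = traj w w.length 0 from rfl, (mem_seqWords.1 hw).1]
    _ ≤ ∑ ω ∈ Zd.bridges 2 n, y ^ (ω n 0).toNat :=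
        Finset.sum_le_sum_of_subset_of_nonneg himg fun _ _ _ => pow_nonneg hy _

/-- **The tilted renewal inequality** `Σ_{s ∈ S, |s| ≤ n} y^{span s} · tseqZ(n − |s|) ≤ tseqZ(n)`: prefixing by
`s` adds `span s` to the span; disjoint in `s` by unique decoding. [cite: Beaton2015, Lemma 1] -/
theorem sum_tseqZ_le (hS : Admissible S) {y : ℝ} (hy : 0 ≤ y) (n : ℕ) :
    ∑ s ∈ S.filter (fun s => s.length ≤ n), y ^ (xEnd s).toNat * tseqZ S y (n - s.length) ≤ tseqZ S y n := by
  classical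
  have hsub : (S.filter fun s => s.length ≤ n).biUnion
      (fun s => (seqWords S (n - s.length)).image (s ++ ·)) ⊆ seqWords S n := by
    intro w hw
    simp only [mem_biUnion, mem_filter, mem_image] at hw
    obtain ⟨s, ⟨hs, hsl⟩, t, ht, rfl⟩ := hw
    obtain ⟨htl, hts⟩ := mem_seqWords.1 ht
    exact mem_seqWords.2 ⟨by simp [htl]; omega, hts.append_left hs⟩
  have hdisj : ((S.filter fun s => s.length ≤ n) : Set (List Step)).PairwiseDisjoint
      (fun s => (seqWords S (n - s.length)).image (s ++ ·)) := by
    intro s hs s' hs' hne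
    simp only [Function.onFun]
    rw [Finset.disjoint_left]
    intro w hw hw'
    simp only [mem_image] at hw hw'
    obtain ⟨t, ht, rfl⟩ := hw
    obtain ⟨t', ht', h⟩ := hw'
    simp only [coe_filter, Set.mem_setOf_eq] at hs hs'
    have h1 := (mem_seqWords.1 ht).2.bridge_saw hS
    have h2 := (mem_seqWords.1 ht').2.bridge_saw hS
    exact hne (eq_of_append_eq (hS s hs.1) (hS s' hs'.1) h1.1 h2.1 h.symm)
  calc ∑ s ∈ S.filter (fun s => s.length ≤ n), y ^ (xEnd s).toNat * tseqZ S y (n - s.length)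
      = ∑ s ∈ S.filter (fun s => s.length ≤ n),
          ∑ w ∈ (seqWords S (n - s.length)).image (s ++ ·), y ^ (xEnd w).toNat := by
        refine Finset.sum_congr rfl fun s hs => ?_
        rw [tseqZ, Finset.mul_sum, Finset.sum_image (fun t _ t' _ h => List.append_cancel_left h)]
        refine Finset.sum_congr rfl fun t ht => ?_
        have hsb : 0 ≤ xEnd s := (hS s (mem_filter.1 hs).1).bridge.xEnd_nonneg
        have htb : 0 ≤ xEnd t := ((mem_seqWords.1 ht).2.bridge_saw hS).1.xEnd_nonneg
        rw [xEnd_append, Int.toNat_add hsb htb, pow_add]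
    _ = ∑ w ∈ (S.filter fun s => s.length ≤ n).biUnion
          (fun s => (seqWords S (n - s.length)).image (s ++ ·)), y ^ (xEnd w).toNat := by
        rw [Finset.sum_biUnion hdisj]
    _ ≤ tseqZ S y n := Finset.sum_le_sum_of_subset_of_nonneg hsub fun _ _ _ => pow_nonneg hy _

/-- **Exponential growth from the tilted Kraft inequality**: if `Σ_{s∈S} x^{|s|} y^{span s} ≥ 1` (`x, y > 0`,
`[+e₀] ∈ S`) then `κ · x^{-n} ≤ tseqZ S y n` for all `n`, for some `κ > 0`.
[cite: Beaton2015, Lemma 2 (finite form)] -/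
theorem exists_mul_pow_le_tseqZ (hS : Admissible S) (hE : [(0 : Step)] ∈ S) {x y : ℝ} (hx : 0 < x)
    (hy : 0 < y) (hK : 1 ≤ ∑ s ∈ S, x ^ s.length * y ^ (xEnd s).toNat) :
    ∃ κ : ℝ, 0 < κ ∧ ∀ n, κ * x⁻¹ ^ n ≤ tseqZ S y n := by
  set N₀ := S.sup List.length with hN₀
  have hlen : ∀ s ∈ S, s.length ≤ N₀ := fun s hs => Finset.le_sup (f := List.length) hs
  have hne : (Finset.range (N₀ + 1)).Nonempty := ⟨0, by simp⟩
  set κ := (Finset.range (N₀ + 1)).inf' hne (fun m => tseqZ S y m * x ^ m) with hκ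
  have hκpos : 0 < κ := by
    rw [hκ, Finset.lt_inf'_iff]
    intro m _
    exact mul_pos (tseqZ_pos hE hy m) (pow_pos hx m)
  have hxinv : ∀ m : ℕ, x⁻¹ ^ m * x ^ m = 1 := fun m => by
    rw [← mul_pow, inv_mul_cancel₀ hx.ne', one_pow]
  have hκle : ∀ m ≤ N₀, κ * x⁻¹ ^ m ≤ tseqZ S y m := by
    intro m hm
    have h1 : κ ≤ tseqZ S y m * x ^ m := Finset.inf'_le _ (by simp; omega)
    have h2 := mul_le_mul_of_nonneg_right h1 (pow_pos (inv_pos.2 hx) m).le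
    calc κ * x⁻¹ ^ m ≤ tseqZ S y m * x ^ m * x⁻¹ ^ m := h2
      _ = tseqZ S y m := by rw [mul_assoc, mul_comm (x ^ m), hxinv, mul_one]
  refine ⟨κ, hκpos, fun n => ?_⟩
  induction n using Nat.strong_induction_on with
  | _ n ih =>
    rcases le_or_gt n N₀ with hn | hn
    · exact hκle n hn
    · have hfil : S.filter (fun s => s.length ≤ n) = S := by
        ext s; simp only [mem_filter, and_iff_left_iff_imp]
        exact fun hs => (hlen s hs).trans hn.le
      have h1 := sum_tseqZ_le hS hy.le n
      rw [hfil] at h1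
      have h2 : ∀ s ∈ S, κ * x⁻¹ ^ n * (x ^ s.length * y ^ (xEnd s).toNat) ≤
          y ^ (xEnd s).toNat * tseqZ S y (n - s.length) := by
        intro s hs
        have hsn : s.length ≤ n := (hlen s hs).trans hn.le
        have hs1 : 1 ≤ s.length := List.length_pos_iff.2 (hS s hs).ne_nil
        have hih := ih (n - s.length) (by omega)
        have hyp : 0 ≤ y ^ (xEnd s).toNat := pow_nonneg hy.le _
        have e : κ * x⁻¹ ^ n * (x ^ s.length * y ^ (xEnd s).toNat) =
            y ^ (xEnd s).toNat * (κ * x⁻¹ ^ (n - s.length)) := by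
          have : x⁻¹ ^ n = x⁻¹ ^ (n - s.length) * x⁻¹ ^ s.length := by
            rw [← pow_add, Nat.sub_add_cancel hsn]
          rw [this]
          have h3 : x⁻¹ ^ s.length * x ^ s.length = 1 := hxinv s.length
          calc κ * (x⁻¹ ^ (n - s.length) * x⁻¹ ^ s.length) * (x ^ s.length * y ^ (xEnd s).toNat)
              = κ * x⁻¹ ^ (n - s.length) * (x⁻¹ ^ s.length * x ^ s.length) * y ^ (xEnd s).toNat := by ring
            _ = y ^ (xEnd s).toNat * (κ * x⁻¹ ^ (n - s.length)) := by rw [h3]; ring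
        rw [e]
        exact mul_le_mul_of_nonneg_left hih hyp
      have hκx : 0 ≤ κ * x⁻¹ ^ n := by positivity
      calc κ * x⁻¹ ^ n ≤ κ * x⁻¹ ^ n * ∑ s ∈ S, x ^ s.length * y ^ (xEnd s).toNat := by
            nlinarith
        _ = ∑ s ∈ S, κ * x⁻¹ ^ n * (x ^ s.length * y ^ (xEnd s).toNat) := by rw [mul_sum]
        _ ≤ ∑ s ∈ S, y ^ (xEnd s).toNat * tseqZ S y (n - s.length) := sum_le_sum h2
        _ ≤ tseqZ S y n := h1

/-- **The pulled-bridge growth from a tilted Kraft certificate** (word model ⇒ bridges): under the hypotheses of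
`exists_mul_pow_le_tseqZ`, `κ · x^{-N} ≤ Z^B_N(y)` for all `N`.
[cite: Beaton2015, Lemma 2 (finite form)] -/
theorem exists_mul_pow_le_pulledBridgeZ (hS : Admissible S) (hE : [(0 : Step)] ∈ S) {x y : ℝ} (hx : 0 < x)
    (hy : 0 < y) (hK : 1 ≤ ∑ s ∈ S, x ^ s.length * y ^ (xEnd s).toNat) :
    ∃ κ : ℝ, 0 < κ ∧ ∀ N, κ * x⁻¹ ^ N ≤ Zd.pulledBridgeZ 2 N y := by
  obtain ⟨κ, hκ, h⟩ := exists_mul_pow_le_tseqZ hS hE hx hy hK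
  exact ⟨κ, hκ, fun N => (h N).trans (tseqZ_le_pulledBridgeZ hS hy.le N)⟩

end Renewal

/-! ### The `y = 2` enclosure, span-1 edition -/

/-- The tilted Kraft sum of the span-1 family at `(x, y)`: `y · (Σ_{k<61} x^{k+1} + Σ_{k<60} x^{k+2})`
(every member has span `1`). [cite: Jensen2004SAWLowerBounds, §2.1] -/
theorem tiltedKraft_spanOneFamily (x y : ℝ) :
    ∑ s ∈ spanOneFamily, x ^ s.length * y ^ (xEnd s).toNat =
      y * (∑ k ∈ Finset.range 61, x ^ (k + 1) + ∑ k ∈ Finset.range 60, x ^ (k + 2)) := by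
  rw [← kraft_spanOneFamily_at x, Finset.mul_sum]
  refine Finset.sum_congr rfl fun s hs => ?_
  rw [(spanOneFamily_spec s hs).2]
  simp only [Int.toNat_one, pow_one]
  ring

/-- **The certificate at `y = 2`**: the tilted Kraft sum of the span-1 family at `x = 351/1250 = 0.2808`,
`y = 2` is `≥ 1` (it equals `1.0001…`). [cite: Jensen2004SAWLowerBounds, §2, eq. (3)–(4)] -/
theorem tiltedKraft_spanOneFamily_two_ge_one :
    (1 : ℝ) ≤ ∑ s ∈ spanOneFamily, (351 / 1250 : ℝ) ^ s.length * (2 : ℝ) ^ (xEnd s).toNat := by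
  rw [tiltedKraft_spanOneFamily]
  have h1 : ∑ k ∈ Finset.range 61, (351 / 1250 : ℝ) ^ (k + 1) =
      351 / 1250 * ∑ k ∈ Finset.range 61, (351 / 1250 : ℝ) ^ k := by
    rw [mul_sum]; refine sum_congr rfl fun k _ => by ring
  have h2 : ∑ k ∈ Finset.range 60, (351 / 1250 : ℝ) ^ (k + 2) =
      (351 / 1250) ^ 2 * ∑ k ∈ Finset.range 60, (351 / 1250 : ℝ) ^ k := by
    rw [mul_sum]; refine sum_congr rfl fun k _ => by ring
  rw [h1, h2, geom_sum_eq (by norm_num), geom_sum_eq (by norm_num)]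
  norm_num

/-- **Lower side of the enclosure at `y = 2` (span-1 edition)**: `∃ κ > 0, ∀ N, κ · (1250/351)^N ≤ Z^B_N(2)`
on `ℤ²` — so the bridge free energy satisfies `e^{λ_B(2)} ≥ 1250/351 = 3.5612…` whenever it exists
(standard axioms). [cite: Beaton2015, Lemma 2; Jensen2004SAWLowerBounds, §2] -/
theorem pulledBridgeZ_two_lower :
    ∃ κ : ℝ, 0 < κ ∧ ∀ N : ℕ, κ * (1250 / 351 : ℝ) ^ N ≤ Zd.pulledBridgeZ 2 N 2 := by
  have hadm : Renewal.Admissible spanOneFamily := fun s hs => (spanOneFamily_spec s hs).1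
  obtain ⟨κ, hκ, h⟩ := Renewal.exists_mul_pow_le_pulledBridgeZ hadm nil_cons_mem_spanOneFamily
    (x := 351 / 1250) (y := 2) (by norm_num) (by norm_num) tiltedKraft_spanOneFamily_two_ge_one
  refine ⟨κ, hκ, fun N => ?_⟩
  have e : ((351 / 1250 : ℝ))⁻¹ = 1250 / 351 := by norm_num
  rw [← e]; exact h N

/-- **The drifted partition function on `ℤ²` is the tilted word sum**: `Z_N(θ) = Σ_{w ∈ sawWords N} e^{θ x(w)}`.
[cite: Beaton2015, §1] -/
theorem driftZ_two_eq_sum_words (n : ℕ) (θ : ℝ) :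
    Zd.driftZ 2 n θ = ∑ w ∈ sawWords n, Real.exp (θ * ((xEnd w : ℤ) : ℝ)) := by
  classical
  unfold Zd.driftZ
  rw [← image_traj_sawWords, Finset.sum_image]
  · refine Finset.sum_congr rfl fun w hw => ?_
    have hl : w.length = n := (mem_sawWords.1 hw).1
    show Real.exp (θ * ((traj w n 0 : ℤ) : ℝ)) = Real.exp (θ * ((xEnd w : ℤ) : ℝ))
    rw [show xEnd w = traj w w.length 0 from rfl, hl]
  · intro w hw w' hw' h
    rw [Finset.mem_coe, mem_sawWords] at hw hw'
    exact eq_of_traj_eq (by rw [hw.1, hw'.1]) h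

/-- **Upper side from ANY tilted memory-`K` certificate**: if `FiniteMemory.checkW K a b N D iters = true`
(`0 < a, b, D`) then `Z_n(log(a/b)) ≤ 2⁴¹ · (N/(D a b))ⁿ` for every `n`.
[cite: PonitzTittmann2000, §3; DuminilCopinHammond2013, §2.4] -/
theorem driftZ_le_of_checkW {K a b N D iters : ℕ} (h : FiniteMemory.checkW K a b N D iters = true)
    (ha : 0 < a) (hb : 0 < b) (hD : 0 < D) (n : ℕ) :
    Zd.driftZ 2 n (Real.log ((a : ℝ) / b)) ≤ 2 ^ 41 * ((N : ℝ) / (D * a * b)) ^ n := by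
  have hr0 : (0 : ℝ) < (a : ℝ) / b := by positivity
  have hab : (0 : ℝ) < (a : ℝ) * b := by positivity
  rw [driftZ_two_eq_sum_words]
  have hterm : ∀ w ∈ sawWords n, Real.exp (Real.log ((a : ℝ) / b) * ((xEnd w : ℤ) : ℝ)) =
      (WordAutomaton.wprod (FiniteMemory.tiltW a b) w : ℝ) / (((a : ℝ) * b) ^ n) := by
    intro w hw
    have hl : w.length = n := (mem_sawWords.1 hw).1
    rw [FiniteMemory.wprod_tiltW_eq ha hb, hl, mul_div_cancel_left₀ _ (pow_ne_zero _ hab.ne'),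
      ← Real.rpow_def_of_pos hr0, Real.rpow_intCast]
  rw [Finset.sum_congr rfl hterm, ← Finset.sum_div, div_le_iff₀ (pow_pos hab n)]
  have hT := FiniteMemory.sum_sawWords_tiltW_mul_pow_le_of_checkW h n
  have hT' : (∑ w ∈ sawWords n, (WordAutomaton.wprod (FiniteMemory.tiltW a b) w : ℝ)) * (D : ℝ) ^ n ≤
      (N : ℝ) ^ n * 2 ^ 41 := by
    exact_mod_cast hT
  have hDn : (0 : ℝ) < (D : ℝ) ^ n := pow_pos (by exact_mod_cast hD) n
  have hre : (2 : ℝ) ^ 41 * ((N : ℝ) / (D * a * b)) ^ n * (((a : ℝ) * b) ^ n) =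
      2 ^ 41 * (N : ℝ) ^ n / (D : ℝ) ^ n := by
    rw [div_pow, mul_pow, mul_pow]
    field_simp
    ring
  rw [hre, le_div_iff₀ hDn]
  calc (∑ w ∈ sawWords n, (WordAutomaton.wprod (FiniteMemory.tiltW a b) w : ℝ)) * (D : ℝ) ^ n
      ≤ (N : ℝ) ^ n * 2 ^ 41 := hT'
    _ = 2 ^ 41 * (N : ℝ) ^ n := mul_comm _ _

/-- **Upper side of the enclosure at `y = 2`**: `∀ N, Z_N(log 2) ≤ 2⁴¹ · (7206013/2000000)^N` on `ℤ²`
(`7206013/2000000 = 3.6030065`, the tilted memory-16 certificate `checkW_16_2_1`); hence `e^{λ(2)} ≤ 3.6030065`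
for the full, half-space and bridge free energies whenever they exist.
[cite: PonitzTittmann2000, §3; Beaton2015, Theorem 1 (for comparison: y_c = 1)] -/
theorem driftZ_two_upper (N : ℕ) :
    Zd.driftZ 2 N (Real.log 2) ≤ 2 ^ 41 * (7206013 / 2000000 : ℝ) ^ N := by
  have h := driftZ_le_of_checkW FiniteMemory.checkW_16_2_1 (by norm_num) (by norm_num) (by norm_num) N
  have e1 : ((2 : ℕ) : ℝ) / ((1 : ℕ) : ℝ) = 2 := by norm_num
  have e2 : ((7206013 : ℕ) : ℝ) / (((1000000 : ℕ) : ℝ) * ((2 : ℕ) : ℝ) * ((1 : ℕ) : ℝ)) = 7206013 / 2000000 := by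
    norm_num
  rw [e1, e2] at h
  exact h

/-- **The two-sided enclosure at `y = 2` in one statement**: there is `κ > 0` with
`κ·(1250/351)^N ≤ Z^B_N(2) ≤ Z_N(log 2) ≤ 2⁴¹·(7206013/2000000)^N` for every `N`
(`3.5612… ≤ e^{λ_B(2)} ≤ e^{λ(2)} ≤ 3.6030065`).
[cite: Beaton2015, Theorem 1 and Lemma 2; PonitzTittmann2000, §3] -/
theorem pulled_enclosure_two :
    ∃ κ : ℝ, 0 < κ ∧ ∀ N : ℕ,
      κ * (1250 / 351 : ℝ) ^ N ≤ Zd.pulledBridgeZ 2 N 2 ∧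
        Zd.pulledBridgeZ 2 N 2 ≤ Zd.driftZ 2 N (Real.log 2) ∧
        Zd.driftZ 2 N (Real.log 2) ≤ 2 ^ 41 * (7206013 / 2000000 : ℝ) ^ N := by
  obtain ⟨κ, hκ, h⟩ := pulledBridgeZ_two_lower
  exact ⟨κ, hκ, fun N => ⟨h N, Zd.pulledBridgeZ_le_driftZ 2 N (by norm_num), driftZ_two_upper N⟩⟩

end Literature.Probability.RandomPlanarGeometry.SAW

end
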